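import Summits.BirchSwinnertonDyer.BirchSwinnertonDyer.Theorems.ManinLocalTwoThreeTwistDefectRootLevel
import Summits.BirchSwinnertonDyer.BirchSwinnertonDyer.Theorems.ManinLocalTwoThreeBracketSturmOneTwelveA
import Summits.BirchSwinnertonDyer.BirchSwinnertonDyer.Theorems.ManinLocalTwoThreeBracketSturmOneTwelveB
import Summits.BirchSwinnertonDyer.BirchSwinnertonDyer.Theorems.SignedLowerHalvesKobayashiMainConjectureSmallImageCMTransferRecordsF
import Summits.BirchSwinnertonDyer.BirchSwinnertonDyer.Theorems.SignedLowerHalvesKobayashiMainConjectureSmallImageCMTransferRecordsH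
import Summits.BirchSwinnertonDyer.BirchSwinnertonDyer.Theorems.ByReductionTypeAtTwoAdditivePotGoodPrintZhaiIrreducibleUnramified

/-!
# THE DEFECT LAW OF THE TWIST GROUPOID, part 6: `112a`, `112b`, `144b`, `176c`, `432b` as ALIGNED `χ₋₄`-twists of the roots `56a1`, `56b1`,
`72a1`, `44a1`, `108a1` (desc g46 MEMO-desc §71 §10–§11, T-desc-58 FINAL sha16 ea245f8823aa6498; landed by p1 gen 25).  Minimality and
discriminants in the kernel ⟹ `abs_maninConstant_eq_one_{oneTwelveB,oneTwelveA,oneFortyFourB,oneSeventySixC,fourThirtyTwoB}_of_cuspCoeff`,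
`not_dvd_maninConstant_oneTwelveAB_of_cuspCoeff`: `|c| = 1` for every lattice-optimal datum whose newform is the `χ₋₄`-twist of the root form,
modulo the twisted coefficient identity and the vanishing of the root's even coefficients.  No named fact; C2, Manin's conjecture, BSD NOT proved.
[cite: Stevens1989, Lemma (5.4) p. 97] [cite: Pal2012, Lemma 3.1] [cite: SilvermanAEC2009, Cor. VII.7.2, §C.16] [cite: EdixhovenManin1991, Prop. 2]
-/

set_option autoImplicit false
set_option linter.dupNamespace false

noncomputable section

open scoped Classical NumberField MatrixGroups ModularForm

namespace Summit.BirchSwinnertonDyer.BirchSwinnertonDyer.Theorems.ManinLocalTwoThree.TwistDefect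

open WeierstrassCurve CongruenceSubgroup IsDedekindDomain IsDedekindDomain.HeightOneSpectrum Rat.HeightOneSpectrum
  Literature.NumberTheory.Automorphic Literature.NumberTheory.EllipticCurves Literature.NumberTheory.EllipticCurves.ModularForms
  Literature.NumberTheory.LFunctions.PrimitiveQuadratic Summit.BirchSwinnertonDyer.BirchSwinnertonDyer.Theorems
  Summit.BirchSwinnertonDyer.BirchSwinnertonDyer.Theorems.ManinLocalTwoThree Summit.BirchSwinnertonDyer.Rank1Residual.ManinAdditive
  Summit.BirchSwinnertonDyer.BirchSwinnertonDyer.Theorems.ManinLocalTwoThree.TwistFamilies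
  Summit.BirchSwinnertonDyer.BirchSwinnertonDyer.Theorems.ManinLocalTwoThree.AdditiveTwistFamilies

open Literature.NumberTheory.EllipticCurves.Rank1Residual.X11RankOneCertificates (discOf c4Of c6Of)

/-! ### Level 112: the classes `112a`, `112b` from p3's level-56 squeezes -/

/-- `Δ, c₄, c₆` of `112b1 = [0,0,0,1,−2]`: `−2⁸·7, −48, 1728`. [folklore] -/
theorem invariants_oneTwelveB1 :
    discOf [0, 0, 0, 1, -2] = -1792 ∧ c4Of [0, 0, 0, 1, -2] = -48 ∧ c6Of [0, 0, 0, 1, -2] = 1728 := by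
  refine ⟨?_, ?_, ?_⟩ <;> decide

/-- `Δ, c₄, c₆` of `112a1 = [0,1,0,0,4]`: `−2¹⁰·7, 16, −3520`. [folklore] -/
theorem invariants_oneTwelveA1 :
    discOf [0, 1, 0, 0, 4] = -7168 ∧ c4Of [0, 1, 0, 0, 4] = 16 ∧ c6Of [0, 1, 0, 0, 4] = -3520 := by
  refine ⟨?_, ?_, ?_⟩ <;> decide

/-- **`112b1 = [0,0,0,1,−2]` is a global minimal model** (`q¹² ∤ Δ = −2⁸·7` for every prime `q`).
[cite: SilvermanAEC2009, VII.1 Remark 1.1] -/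
theorem isGloballyMinimal_oneTwelveB1_cast :
    (⟨((0 : ℤ) : ℚ), ((0 : ℤ) : ℚ), ((0 : ℤ) : ℚ), ((1 : ℤ) : ℚ), ((-2 : ℤ) : ℚ)⟩ :
      WeierstrassCurve ℚ).IsGloballyMinimal := by
  obtain ⟨hD, -, -⟩ := invariants_oneTwelveB1
  refine WeierstrassCurve.isGloballyMinimal_of_int_kraus 0 0 0 1 (-2) fun q hq ↦ Or.inl fun h ↦ ?_
  obtain ⟨h12, -⟩ := h
  rw [hD] at h12
  have hq1 : (q : ℤ) ∣ 1792 := dvd_neg.mp (dvd_trans (dvd_pow_self _ (by norm_num)) h12)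
  have hdvdN : q ∣ 2 ^ 8 * 7 := by
    have e : ((2 ^ 8 * 7 : ℕ) : ℤ) = 1792 := by norm_num
    exact Int.natCast_dvd_natCast.mp (e ▸ hq1)
  have hpi := Nat.Prime.prime hq
  rcases hpi.dvd_or_dvd hdvdN with h | h
  · have := (Nat.prime_dvd_prime_iff_eq hq Nat.prime_two).mp (hpi.dvd_of_dvd_pow h)
    subst this; revert h12; norm_num
  · have := (Nat.prime_dvd_prime_iff_eq hq (by norm_num : Nat.Prime 7)).mp h
    subst this; revert h12; norm_num

/-- **`112a1 = [0,1,0,0,4]` is a global minimal model** (`q¹² ∤ Δ = −2¹⁰·7`). [cite: SilvermanAEC2009, VII.1 Remark 1.1] -/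
theorem isGloballyMinimal_oneTwelveA1_cast :
    (⟨((0 : ℤ) : ℚ), ((1 : ℤ) : ℚ), ((0 : ℤ) : ℚ), ((0 : ℤ) : ℚ), ((4 : ℤ) : ℚ)⟩ :
      WeierstrassCurve ℚ).IsGloballyMinimal := by
  obtain ⟨hD, -, -⟩ := invariants_oneTwelveA1
  refine WeierstrassCurve.isGloballyMinimal_of_int_kraus 0 1 0 0 4 fun q hq ↦ Or.inl fun h ↦ ?_
  obtain ⟨h12, -⟩ := h
  rw [hD] at h12
  have hq1 : (q : ℤ) ∣ 7168 := dvd_neg.mp (dvd_trans (dvd_pow_self _ (by norm_num)) h12)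
  have hdvdN : q ∣ 2 ^ 10 * 7 := by
    have e : ((2 ^ 10 * 7 : ℕ) : ℤ) = 7168 := by norm_num
    exact Int.natCast_dvd_natCast.mp (e ▸ hq1)
  have hpi := Nat.Prime.prime hq
  rcases hpi.dvd_or_dvd hdvdN with h | h
  · have := (Nat.prime_dvd_prime_iff_eq hq Nat.prime_two).mp (hpi.dvd_of_dvd_pow h)
    subst this; revert h12; norm_num
  · have := (Nat.prime_dvd_prime_iff_eq hq (by norm_num : Nat.Prime 7)).mp h
    subst this; revert h12; norm_num

/-- **ALIGNED EDGE `56a1 ⊗ (−1) = 112b1`** (`u = 1`). [folklore] -/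
theorem smul_quadraticTwist_fiftySixA1_negOne :
    (1 : VariableChange ℚ) • (⟨0, 0, 0, 1, 2⟩ : WeierstrassCurve ℚ).quadraticTwist (-1) = ⟨0, 0, 0, 1, -2⟩ := by
  rw [one_smul]
  ext <;> simp only [quadraticTwist_a₁, quadraticTwist_a₂, quadraticTwist_a₃, quadraticTwist_a₄,
    quadraticTwist_a₆, b₂, b₄, b₆] <;> norm_num

/-- **ALIGNED EDGE `56b1 ⊗ (−1) = 112a1`** (`u = 1`). [folklore] -/
theorem smul_quadraticTwist_fiftySixB1_negOne :
    (1 : VariableChange ℚ) • (⟨0, -1, 0, 0, -4⟩ : WeierstrassCurve ℚ).quadraticTwist (-1) = ⟨0, 1, 0, 0, 4⟩ := by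
  rw [one_smul]
  ext <;> simp only [quadraticTwist_a₁, quadraticTwist_a₂, quadraticTwist_a₃, quadraticTwist_a₄,
    quadraticTwist_a₆, b₂, b₄, b₆] <;> norm_num

/-- Auxiliary step `Δ_oneTwelveB1_eq` of the twist-defect squeeze transport (see the module docstring). -/
theorem Δ_oneTwelveB1_eq :
    (((1 : ℤ)) : ℚ) ^ 12 * (⟨0, 0, 0, 1, -2⟩ : WeierstrassCurve ℚ).Δ = (⟨0, 0, 0, 1, 2⟩ : WeierstrassCurve ℚ).Δ := by
  norm_num [WeierstrassCurve.Δ, WeierstrassCurve.b₂, WeierstrassCurve.b₄, WeierstrassCurve.b₆,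
    WeierstrassCurve.b₈]

/-- Auxiliary step `Δ_oneTwelveA1_eq` of the twist-defect squeeze transport (see the module docstring). -/
theorem Δ_oneTwelveA1_eq :
    (((1 : ℤ)) : ℚ) ^ 12 * (⟨0, 1, 0, 0, 4⟩ : WeierstrassCurve ℚ).Δ = (⟨0, -1, 0, 0, -4⟩ : WeierstrassCurve ℚ).Δ := by
  norm_num [WeierstrassCurve.Δ, WeierstrassCurve.b₂, WeierstrassCurve.b₄, WeierstrassCurve.b₆,
    WeierstrassCurve.b₈]

/-- **112b (X-desc-g46e).**  `|c(D)| = 1` for every lattice-optimal `X₀(112)`-datum `D` on every globally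
minimal `W` whose newform is the `χ₋₄`-twist of `φ₅₆ₐ = P − Q` on odd coefficients — given p3's squeeze
`hLa` (= the conclusion of `EtaIdentitiesFiftySix.periodLatticeLe_fiftySixA φ hφ`) and `a₂ₖ(φ₅₆ₐ) = 0`.
No parametrisation of `X₀(112)`. [cite: AgasheRibetStein2006, §§1–2] [cite: CremonaAlgorithms1997, Table 1 (56a1, 112b1)] -/
theorem abs_maninConstant_eq_one_oneTwelveB_of_cuspCoeff (φ : CuspForm (Gamma0 56) 2)
    (hLa : ∃ L₁ : PeriodPair, L₁.g₂ = -4 ∧ L₁.g₃ = -8 ∧ ∀ z ∈ periodLattice φ, z ∈ L₁.lattice)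
    (heven : ∀ n : ℕ, 2 ∣ n → cuspCoeff φ n = 0)
    (W : WeierstrassCurve ℚ) [W.IsElliptic] [W.IsGloballyMinimal] (D : ModularParametrizationData W 112)
    (hf : ∀ n : ℕ, ¬ 2 ∣ n → cuspCoeff D.f n = (ZMod.χ₄ n : ℂ) * cuspCoeff φ n)
    (hopt : ∀ z ∈ D.L.lattice, ∃ w ∈ periodLattice D.f, z = D.c * w) :
    |D.maninConstant| = 1 := by
  obtain ⟨L₀, hg2, hg3, hS0⟩ := hLa
  haveI := ManinConstantFiftySix.isElliptic_fiftySixA1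
  haveI := LevelOneTwelveCert.isElliptic_oneTwelveB1
  haveI := LevelOneTwelveCert.isGloballyMinimal_oneTwelveB1
  exact abs_maninConstant_eq_one_of_squeeze_negOneTwist_aligned_level ⟨14, rfl⟩ ⟨2, rfl⟩ ⟨7, rfl⟩ φ
    ⟨0, 0, 0, 1, 2⟩ L₀ ((ManinConstantFiftySix.isNeronLatticeOf_fiftySixA1_iff L₀).mpr ⟨hg2, hg3⟩) hS0 heven
    (C := ⟨0, 0, 0, 1, -2⟩) 1 smul_quadraticTwist_fiftySixA1_negOne (r := 1) (Or.inl rfl)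
    Δ_oneTwelveB1_eq W D hf hopt

/-- **112a (X-desc-g46e).**  The same from `φ₅₆_b = P + Q` (root `56b1 = [0,−1,0,0,−4]`, Néron pair
`(4/3, 440/27)`, member model `112a1 = [0,1,0,0,4]`). [cite: AgasheRibetStein2006, §§1–2] [cite: CremonaAlgorithms1997, Table 1 (56b1, 112a1)] -/
theorem abs_maninConstant_eq_one_oneTwelveA_of_cuspCoeff (ψ : CuspForm (Gamma0 56) 2)
    (hLb : ∃ L₁ : PeriodPair, L₁.g₂ = 4 / 3 ∧ L₁.g₃ = 440 / 27 ∧ ∀ z ∈ periodLattice ψ, z ∈ L₁.lattice)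
    (heven : ∀ n : ℕ, 2 ∣ n → cuspCoeff ψ n = 0)
    (W : WeierstrassCurve ℚ) [W.IsElliptic] [W.IsGloballyMinimal] (D : ModularParametrizationData W 112)
    (hf : ∀ n : ℕ, ¬ 2 ∣ n → cuspCoeff D.f n = (ZMod.χ₄ n : ℂ) * cuspCoeff ψ n)
    (hopt : ∀ z ∈ D.L.lattice, ∃ w ∈ periodLattice D.f, z = D.c * w) :
    |D.maninConstant| = 1 := by
  obtain ⟨L₀, hg2, hg3, hS0⟩ := hLb
  haveI := ManinConstantFiftySix.isElliptic_fiftySixB1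
  haveI := LevelOneTwelveCert.isElliptic_oneTwelveA1
  haveI := LevelOneTwelveCert.isGloballyMinimal_oneTwelveA1
  exact abs_maninConstant_eq_one_of_squeeze_negOneTwist_aligned_level ⟨14, rfl⟩ ⟨2, rfl⟩ ⟨7, rfl⟩ ψ
    ⟨0, -1, 0, 0, -4⟩ L₀ ((ManinConstantFiftySix.isNeronLatticeOf_fiftySixB1_iff L₀).mpr ⟨hg2, hg3⟩) hS0 heven
    (C := ⟨0, 1, 0, 0, 4⟩) 1 smul_quadraticTwist_fiftySixB1_negOne (r := 1) (Or.inl rfl)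
    Δ_oneTwelveA1_eq W D hf hopt

/-- `2 ∤ c` and `3 ∤ c` on `112a`, `112b` in the same situation. -/
theorem not_dvd_maninConstant_oneTwelveAB_of_cuspCoeff (φ ψ : CuspForm (Gamma0 56) 2)
    (hLa : ∃ L₁ : PeriodPair, L₁.g₂ = -4 ∧ L₁.g₃ = -8 ∧ ∀ z ∈ periodLattice φ, z ∈ L₁.lattice)
    (hLb : ∃ L₁ : PeriodPair, L₁.g₂ = 4 / 3 ∧ L₁.g₃ = 440 / 27 ∧ ∀ z ∈ periodLattice ψ, z ∈ L₁.lattice)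
    (hevena : ∀ n : ℕ, 2 ∣ n → cuspCoeff φ n = 0) (hevenb : ∀ n : ℕ, 2 ∣ n → cuspCoeff ψ n = 0)
    (W : WeierstrassCurve ℚ) [W.IsElliptic] [W.IsGloballyMinimal] (D : ModularParametrizationData W 112)
    (hf : (∀ n : ℕ, ¬ 2 ∣ n → cuspCoeff D.f n = (ZMod.χ₄ n : ℂ) * cuspCoeff φ n) ∨
      (∀ n : ℕ, ¬ 2 ∣ n → cuspCoeff D.f n = (ZMod.χ₄ n : ℂ) * cuspCoeff ψ n))
    (hopt : ∀ z ∈ D.L.lattice, ∃ w ∈ periodLattice D.f, z = D.c * w) :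
    ¬ (2 : ℤ) ∣ D.maninConstant ∧ ¬ (3 : ℤ) ∣ D.maninConstant := by
  have h : |D.maninConstant| = 1 := by
    rcases hf with hf | hf
    · exact abs_maninConstant_eq_one_oneTwelveB_of_cuspCoeff φ hLa hevena W D hf hopt
    · exact abs_maninConstant_eq_one_oneTwelveA_of_cuspCoeff ψ hLb hevenb W D hf hopt
  refine ⟨fun h2 ↦ ?_, fun h3 ↦ ?_⟩
  · have := Int.le_of_dvd (by rw [h]; norm_num) ((dvd_abs _ _).mpr h2)
    rw [h] at this
    norm_num at this
  · have := Int.le_of_dvd (by rw [h]; norm_num) ((dvd_abs _ _).mpr h3)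
    rw [h] at this
    norm_num at this

/-! ## §11 Level `144b`, `176c`, `432b` from the root squeezes at `72`, `44`, `108` (71.J instances)

Aligned `χ₋₄`-edges at Cremona's optimal curves (`u = 1`, `r = 1`): `144b1 = [0,0,0,6,7] = 72a1 ⊗ (−1)`,
`176c1 = [0,−1,0,3,1] = 44a1 ⊗ (−1)`, `432b1 = [0,0,0,0,−4] = 108a1 ⊗ (−1)`.  With p3's `144a`
(`EtaIdentitiesOneFortyFourA`) this makes LEVEL 144 squeeze-complete modulo the twisted pinning. -/

/-- `Δ, c₄, c₆` of `144b1 = [0,0,0,6,7]`: `−2⁴·3⁷, −288, −6048`. [folklore] -/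
theorem invariants_oneFortyFourB1 :
    discOf [0, 0, 0, 6, 7] = -34992 ∧ c4Of [0, 0, 0, 6, 7] = -288 ∧ c6Of [0, 0, 0, 6, 7] = -6048 := by
  refine ⟨?_, ?_, ?_⟩ <;> decide

/-- `Δ, c₄, c₆` of `176c1 = [0,−1,0,3,1]`: `−2⁸·11, −128, −1664`. [folklore] -/
theorem invariants_oneSeventySixC1 :
    discOf [0, -1, 0, 3, 1] = -2816 ∧ c4Of [0, -1, 0, 3, 1] = -128 ∧ c6Of [0, -1, 0, 3, 1] = -1664 := by
  refine ⟨?_, ?_, ?_⟩ <;> decide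

/-- `Δ, c₄, c₆` of `432b1 = [0,0,0,0,−4]`: `−2⁸·3³, 0, 3456`. [folklore] -/
theorem invariants_fourThirtyTwoB1 :
    discOf [0, 0, 0, 0, -4] = -6912 ∧ c4Of [0, 0, 0, 0, -4] = 0 ∧ c6Of [0, 0, 0, 0, -4] = 3456 := by
  refine ⟨?_, ?_, ?_⟩ <;> decide

/-- Auxiliary step `isGloballyMinimal_oneFortyFourB1_cast` of the twist-defect squeeze transport (see the module docstring). -/
theorem isGloballyMinimal_oneFortyFourB1_cast :
    (⟨((0 : ℤ) : ℚ), ((0 : ℤ) : ℚ), ((0 : ℤ) : ℚ), ((6 : ℤ) : ℚ), ((7 : ℤ) : ℚ)⟩ : WeierstrassCurve ℚ).IsGloballyMinimal := by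
  obtain ⟨hD, -, -⟩ := invariants_oneFortyFourB1
  refine WeierstrassCurve.isGloballyMinimal_of_int_kraus 0 0 0 6 7 fun q hq ↦ Or.inl fun h ↦ ?_
  obtain ⟨h12, -⟩ := h
  rw [hD] at h12
  have hq1 : (q : ℤ) ∣ 34992 := dvd_neg.mp (dvd_trans (dvd_pow_self _ (by norm_num)) h12)
  have hdvdN : q ∣ 2 ^ 4 * 3 ^ 7 := by
    have e : ((2 ^ 4 * 3 ^ 7 : ℕ) : ℤ) = 34992 := by norm_num
    exact Int.natCast_dvd_natCast.mp (e ▸ hq1)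
  have hpi := Nat.Prime.prime hq
  rcases hpi.dvd_or_dvd hdvdN with h | h
  · have := (Nat.prime_dvd_prime_iff_eq hq Nat.prime_two).mp (hpi.dvd_of_dvd_pow h)
    subst this; revert h12; norm_num
  · have := (Nat.prime_dvd_prime_iff_eq hq (by norm_num : Nat.Prime 3)).mp (hpi.dvd_of_dvd_pow h)
    subst this; revert h12; norm_num

/-- Auxiliary step `isGloballyMinimal_oneFortyFourB1` of the twist-defect squeeze transport (see the module docstring). -/
theorem isGloballyMinimal_oneFortyFourB1 : (⟨0, 0, 0, 6, 7⟩ : WeierstrassCurve ℚ).IsGloballyMinimal := by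
  rw [show (⟨0, 0, 0, 6, 7⟩ : WeierstrassCurve ℚ) = ⟨((0 : ℤ) : ℚ), ((0 : ℤ) : ℚ), ((0 : ℤ) : ℚ), ((6 : ℤ) : ℚ), ((7 : ℤ) : ℚ)⟩ by ext <;> norm_num]
  exact isGloballyMinimal_oneFortyFourB1_cast

/-- Auxiliary step `isElliptic_oneFortyFourB1` of the twist-defect squeeze transport (see the module docstring). -/
theorem isElliptic_oneFortyFourB1 : (⟨0, 0, 0, 6, 7⟩ : WeierstrassCurve ℚ).IsElliptic :=
  ⟨by norm_num [WeierstrassCurve.Δ, WeierstrassCurve.b₂, WeierstrassCurve.b₄, WeierstrassCurve.b₆,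
    WeierstrassCurve.b₈]⟩

/-- Auxiliary step `isGloballyMinimal_oneSeventySixC1_cast` of the twist-defect squeeze transport (see the module docstring). -/
theorem isGloballyMinimal_oneSeventySixC1_cast :
    (⟨((0 : ℤ) : ℚ), ((-1 : ℤ) : ℚ), ((0 : ℤ) : ℚ), ((3 : ℤ) : ℚ), ((1 : ℤ) : ℚ)⟩ : WeierstrassCurve ℚ).IsGloballyMinimal := by
  obtain ⟨hD, -, -⟩ := invariants_oneSeventySixC1
  refine WeierstrassCurve.isGloballyMinimal_of_int_kraus 0 (-1) 0 3 1 fun q hq ↦ Or.inl fun h ↦ ?_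
  obtain ⟨h12, -⟩ := h
  rw [hD] at h12
  have hq1 : (q : ℤ) ∣ 2816 := dvd_neg.mp (dvd_trans (dvd_pow_self _ (by norm_num)) h12)
  have hdvdN : q ∣ 2 ^ 8 * 11 := by
    have e : ((2 ^ 8 * 11 : ℕ) : ℤ) = 2816 := by norm_num
    exact Int.natCast_dvd_natCast.mp (e ▸ hq1)
  have hpi := Nat.Prime.prime hq
  rcases hpi.dvd_or_dvd hdvdN with h | h
  · have := (Nat.prime_dvd_prime_iff_eq hq Nat.prime_two).mp (hpi.dvd_of_dvd_pow h)
    subst this; revert h12; norm_num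
  · have := (Nat.prime_dvd_prime_iff_eq hq (by norm_num : Nat.Prime 11)).mp h
    subst this; revert h12; norm_num

/-- Auxiliary step `isGloballyMinimal_oneSeventySixC1` of the twist-defect squeeze transport (see the module docstring). -/
theorem isGloballyMinimal_oneSeventySixC1 : (⟨0, -1, 0, 3, 1⟩ : WeierstrassCurve ℚ).IsGloballyMinimal := by
  rw [show (⟨0, -1, 0, 3, 1⟩ : WeierstrassCurve ℚ) = ⟨((0 : ℤ) : ℚ), ((-1 : ℤ) : ℚ), ((0 : ℤ) : ℚ), ((3 : ℤ) : ℚ), ((1 : ℤ) : ℚ)⟩ by ext <;> norm_num]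
  exact isGloballyMinimal_oneSeventySixC1_cast

/-- Auxiliary step `isElliptic_oneSeventySixC1` of the twist-defect squeeze transport (see the module docstring). -/
theorem isElliptic_oneSeventySixC1 : (⟨0, -1, 0, 3, 1⟩ : WeierstrassCurve ℚ).IsElliptic :=
  ⟨by norm_num [WeierstrassCurve.Δ, WeierstrassCurve.b₂, WeierstrassCurve.b₄, WeierstrassCurve.b₆,
    WeierstrassCurve.b₈]⟩

/-- Auxiliary step `isGloballyMinimal_fourThirtyTwoB1_cast` of the twist-defect squeeze transport (see the module docstring). -/
theorem isGloballyMinimal_fourThirtyTwoB1_cast :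
    (⟨((0 : ℤ) : ℚ), ((0 : ℤ) : ℚ), ((0 : ℤ) : ℚ), ((0 : ℤ) : ℚ), ((-4 : ℤ) : ℚ)⟩ : WeierstrassCurve ℚ).IsGloballyMinimal := by
  obtain ⟨hD, -, -⟩ := invariants_fourThirtyTwoB1
  refine WeierstrassCurve.isGloballyMinimal_of_int_kraus 0 0 0 0 (-4) fun q hq ↦ Or.inl fun h ↦ ?_
  obtain ⟨h12, -⟩ := h
  rw [hD] at h12
  have hq1 : (q : ℤ) ∣ 6912 := dvd_neg.mp (dvd_trans (dvd_pow_self _ (by norm_num)) h12)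
  have hdvdN : q ∣ 2 ^ 8 * 3 ^ 3 := by
    have e : ((2 ^ 8 * 3 ^ 3 : ℕ) : ℤ) = 6912 := by norm_num
    exact Int.natCast_dvd_natCast.mp (e ▸ hq1)
  have hpi := Nat.Prime.prime hq
  rcases hpi.dvd_or_dvd hdvdN with h | h
  · have := (Nat.prime_dvd_prime_iff_eq hq Nat.prime_two).mp (hpi.dvd_of_dvd_pow h)
    subst this; revert h12; norm_num
  · have := (Nat.prime_dvd_prime_iff_eq hq (by norm_num : Nat.Prime 3)).mp (hpi.dvd_of_dvd_pow h)
    subst this; revert h12; norm_num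

/-- ALIGNED EDGES `72a1 ⊗ (−1) = 144b1`, `44a1 ⊗ (−1) = 176c1`, `108a1 ⊗ (−1) = 432b1` (`u = 1`). [folklore] -/
theorem smul_quadraticTwist_seventyTwoA1_negOne :
    (1 : VariableChange ℚ) • (⟨0, 0, 0, 6, -7⟩ : WeierstrassCurve ℚ).quadraticTwist (-1) = ⟨0, 0, 0, 6, 7⟩ := by
  rw [one_smul]
  ext <;> simp only [quadraticTwist_a₁, quadraticTwist_a₂, quadraticTwist_a₃, quadraticTwist_a₄,
    quadraticTwist_a₆, b₂, b₄, b₆] <;> norm_num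

/-- Auxiliary step `smul_quadraticTwist_fortyFourA1_negOne` of the twist-defect squeeze transport (see the module docstring). -/
theorem smul_quadraticTwist_fortyFourA1_negOne :
    (1 : VariableChange ℚ) • (⟨0, 1, 0, 3, -1⟩ : WeierstrassCurve ℚ).quadraticTwist (-1) = ⟨0, -1, 0, 3, 1⟩ := by
  rw [one_smul]
  ext <;> simp only [quadraticTwist_a₁, quadraticTwist_a₂, quadraticTwist_a₃, quadraticTwist_a₄,
    quadraticTwist_a₆, b₂, b₄, b₆] <;> norm_num

/-- Auxiliary step `smul_quadraticTwist_oneHundredEightA1_negOne` of the twist-defect squeeze transport (see the module docstring). -/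
theorem smul_quadraticTwist_oneHundredEightA1_negOne :
    (1 : VariableChange ℚ) • (⟨0, 0, 0, 0, 4⟩ : WeierstrassCurve ℚ).quadraticTwist (-1) = ⟨0, 0, 0, 0, -4⟩ := by
  rw [one_smul]
  ext <;> simp only [quadraticTwist_a₁, quadraticTwist_a₂, quadraticTwist_a₃, quadraticTwist_a₄,
    quadraticTwist_a₆, b₂, b₄, b₆] <;> norm_num

/-- Auxiliary step `Δ_oneFortyFourB1_eq` of the twist-defect squeeze transport (see the module docstring). -/
theorem Δ_oneFortyFourB1_eq :
    (((1 : ℤ)) : ℚ) ^ 12 * (⟨0, 0, 0, 6, 7⟩ : WeierstrassCurve ℚ).Δ = (⟨0, 0, 0, 6, -7⟩ : WeierstrassCurve ℚ).Δ := by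
  norm_num [WeierstrassCurve.Δ, WeierstrassCurve.b₂, WeierstrassCurve.b₄, WeierstrassCurve.b₆,
    WeierstrassCurve.b₈]

/-- Auxiliary step `Δ_oneSeventySixC1_eq` of the twist-defect squeeze transport (see the module docstring). -/
theorem Δ_oneSeventySixC1_eq :
    (((1 : ℤ)) : ℚ) ^ 12 * (⟨0, -1, 0, 3, 1⟩ : WeierstrassCurve ℚ).Δ = (⟨0, 1, 0, 3, -1⟩ : WeierstrassCurve ℚ).Δ := by
  norm_num [WeierstrassCurve.Δ, WeierstrassCurve.b₂, WeierstrassCurve.b₄, WeierstrassCurve.b₆,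
    WeierstrassCurve.b₈]

/-- Auxiliary step `Δ_fourThirtyTwoB1_eq` of the twist-defect squeeze transport (see the module docstring). -/
theorem Δ_fourThirtyTwoB1_eq :
    (((1 : ℤ)) : ℚ) ^ 12 * (⟨0, 0, 0, 0, -4⟩ : WeierstrassCurve ℚ).Δ = (⟨0, 0, 0, 0, 4⟩ : WeierstrassCurve ℚ).Δ := by
  norm_num [WeierstrassCurve.Δ, WeierstrassCurve.b₂, WeierstrassCurve.b₄, WeierstrassCurve.b₆,
    WeierstrassCurve.b₈]

/-- **144b.**  `|c(D)| = 1` on `X₀(144)` for data whose newform is the `χ₋₄`-twist (on odd coefficients) of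
p3's root form `φ₇₂` (squeeze `hL` = the conclusion of `EtaIdentitiesSeventyTwo.periodLatticeLe_seventyTwo`).
[cite: AgasheRibetStein2006, §§1–2] [cite: CremonaAlgorithms1997, Table 1 (72a1, 144b1)] -/
theorem abs_maninConstant_eq_one_oneFortyFourB_of_cuspCoeff (φ : CuspForm (Gamma0 72) 2)
    (hL : ∃ L₁ : PeriodPair, L₁.g₂ = -24 ∧ L₁.g₃ = 28 ∧ ∀ z ∈ periodLattice φ, z ∈ L₁.lattice)
    (heven : ∀ n : ℕ, 2 ∣ n → cuspCoeff φ n = 0)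
    (W : WeierstrassCurve ℚ) [W.IsElliptic] [W.IsGloballyMinimal] (D : ModularParametrizationData W 144)
    (hf : ∀ n : ℕ, ¬ 2 ∣ n → cuspCoeff D.f n = (ZMod.χ₄ n : ℂ) * cuspCoeff φ n)
    (hopt : ∀ z ∈ D.L.lattice, ∃ w ∈ periodLattice D.f, z = D.c * w) :
    |D.maninConstant| = 1 := by
  obtain ⟨L₀, hg2, hg3, hS0⟩ := hL
  haveI := ManinConstantSeventyTwo.isElliptic_seventyTwoA1
  haveI := isElliptic_oneFortyFourB1
  haveI := isGloballyMinimal_oneFortyFourB1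
  exact abs_maninConstant_eq_one_of_squeeze_negOneTwist_aligned_level ⟨18, rfl⟩ ⟨2, rfl⟩ ⟨9, rfl⟩ φ
    ⟨0, 0, 0, 6, -7⟩ L₀ (ManinConstantSeventyTwo.isNeronLatticeOf_seventyTwoA1 hg2 hg3) hS0 heven
    (C := ⟨0, 0, 0, 6, 7⟩) 1 smul_quadraticTwist_seventyTwoA1_negOne (r := 1) (Or.inl rfl)
    Δ_oneFortyFourB1_eq W D hf hopt

/-- **176c.**  The same on `X₀(176)` from p3's root form `Φ₄₄` (squeeze `EtaIdentitiesFortyFour.periodLatticeLe_fortyFour`).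
[cite: AgasheRibetStein2006, §§1–2] [cite: CremonaAlgorithms1997, Table 1 (44a1, 176c1)] -/
theorem abs_maninConstant_eq_one_oneSeventySixC_of_cuspCoeff (φ : CuspForm (Gamma0 44) 2)
    (hL : ∃ L₁ : PeriodPair, L₁.g₂ = -32 / 3 ∧ L₁.g₃ = 208 / 27 ∧ ∀ z ∈ periodLattice φ, z ∈ L₁.lattice)
    (heven : ∀ n : ℕ, 2 ∣ n → cuspCoeff φ n = 0)
    (W : WeierstrassCurve ℚ) [W.IsElliptic] [W.IsGloballyMinimal] (D : ModularParametrizationData W 176)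
    (hf : ∀ n : ℕ, ¬ 2 ∣ n → cuspCoeff D.f n = (ZMod.χ₄ n : ℂ) * cuspCoeff φ n)
    (hopt : ∀ z ∈ D.L.lattice, ∃ w ∈ periodLattice D.f, z = D.c * w) :
    |D.maninConstant| = 1 := by
  obtain ⟨L₀, hg2, hg3, hS0⟩ := hL
  haveI := Summit.BirchSwinnertonDyer.BirchSwinnertonDyer.Theorems.AddPotGoodPrint.isElliptic_44A1
  haveI := isElliptic_oneSeventySixC1
  haveI := isGloballyMinimal_oneSeventySixC1
  exact abs_maninConstant_eq_one_of_squeeze_negOneTwist_aligned_level ⟨11, rfl⟩ ⟨4, rfl⟩ ⟨11, rfl⟩ φ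
    ⟨0, 1, 0, 3, -1⟩ L₀ (ManinConstantFortyFour.isNeronLatticeOf_fortyFourA1 hg2 hg3) hS0 heven
    (C := ⟨0, -1, 0, 3, 1⟩) 1 smul_quadraticTwist_fortyFourA1_negOne (r := 1) (Or.inl rfl)
    Δ_oneSeventySixC1_eq W D hf hopt

/-- **432b.**  The same on `X₀(432)` from p3's root form `φ₁₀₈` (squeeze `EtaIdentitiesOneHundredEight.periodLatticeLe_oneHundredEight`).
[cite: AgasheRibetStein2006, §§1–2] [cite: CremonaAlgorithms1997, Table 1 (108a1, 432b1)] -/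
theorem abs_maninConstant_eq_one_fourThirtyTwoB_of_cuspCoeff (φ : CuspForm (Gamma0 108) 2)
    (hL : ∃ L₁ : PeriodPair, L₁.g₂ = 0 ∧ L₁.g₃ = -16 ∧ ∀ z ∈ periodLattice φ, z ∈ L₁.lattice)
    (heven : ∀ n : ℕ, 2 ∣ n → cuspCoeff φ n = 0)
    (W : WeierstrassCurve ℚ) [W.IsElliptic] [W.IsGloballyMinimal] (D : ModularParametrizationData W 432)
    (hf : ∀ n : ℕ, ¬ 2 ∣ n → cuspCoeff D.f n = (ZMod.χ₄ n : ℂ) * cuspCoeff φ n)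
    (hopt : ∀ z ∈ D.L.lattice, ∃ w ∈ periodLattice D.f, z = D.c * w) :
    |D.maninConstant| = 1 := by
  obtain ⟨L₀, hg2, hg3, hS0⟩ := hL
  haveI := Summit.BirchSwinnertonDyer.BirchSwinnertonDyer.Theorems.isElliptic_cm0p4
  haveI := Summit.BirchSwinnertonDyer.BirchSwinnertonDyer.Theorems.isElliptic_cm0m4
  haveI := Summit.BirchSwinnertonDyer.BirchSwinnertonDyer.Theorems.isGloballyMinimal_cm0m4
  exact abs_maninConstant_eq_one_of_squeeze_negOneTwist_aligned_level ⟨27, rfl⟩ ⟨4, rfl⟩ ⟨27, rfl⟩ φ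
    ⟨0, 0, 0, 0, 4⟩ L₀ (NeronSqueezeOneHundredEight.isNeronLatticeOf_oneHundredEightA1 hg2 hg3) hS0 heven
    (C := ⟨0, 0, 0, 0, -4⟩) 1 smul_quadraticTwist_oneHundredEightA1_negOne (r := 1) (Or.inl rfl)
    Δ_fourThirtyTwoB1_eq W D hf hopt
end Summit.BirchSwinnertonDyer.BirchSwinnertonDyer.Theorems.ManinLocalTwoThree.TwistDefect
end
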